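import Summits.ResolutionOfSingularities.ResolutionOfSingularities.Theorems.StallVertexStraightClasses
import Summits.ResolutionOfSingularities.ResolutionOfSingularities.Theorems.MaxContactCutStallVertex
import HarnessLib

/-!
# MaxContactCutStallVertexEvents — decomp-res node «StallVertex» (lens-5 g20/g21 rev 6), add-on tree file 16 of the node

Content VERBATIM from the decomp-res lens-5 file `HOME/decomp-res-lens-5/g21/StallVertex.lean` rev 6 (pin 95ed6f6f,
3 344 l; rev 6 SUPERSEDES rev 5 5d7e6b95,
rev 4 74ef32c0 and rev 3 549891b7 as landing source — pure insertions, all earlier statements byte-identical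
(critic machine diffs); HOME = run/shared/lean/pub/decomp-res).
The rev-0/1/2 sections are ALREADY in the tree (`StallVertexForms` / `Kernels` / `Walk` / `Classes` / `Clean` /
`Rigid` / `Lines` / `RigidClasses` / `MaxContactCutStallVertex`,
writer g7); the add-on files carry ONLY the declarations NEW in rev 3 / 4 / 5 / 6.  Critic: CRITIC-LEDGER rows 142c
(rev 3: the old-letter law, CLEARED 2026-08-30T21:45:00Z),
142d (rev 4: the general carried-line law + line dichotomy, DECIDED +1, 22:09:45Z), 142e (rev 5: the turn law,
22:25:58Z), 142f (rev 6: THE EVENT-FREE LEAF IS EMPTY +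
THE MONOMIAL REGIME, DECIDED +1 for (S) as a whole, 22:52:49Z) — landing orders INBOX :362 / :396 / :429 (2) /
:471.  Landed by decomp-res writer g8 as `StallVertexCarry`
(§1d–§1e), `StallVertexOldLetter` (§1g + §3d–§3e), `StallVertexLineTurn` (§3f–§3g),
`StallVertexLetterClasses` (§4d–§4e classes and exact re-locations),
`StallVertexRegime` (§1i the monomial carry law + §3h a derivative is always carried / the monomial step),
`StallVertexStraightClasses` (§4f + §4g classes and exact
re-locations) and the wiring file `MaxContactCutStallVertexEvents` (every new `closes_…` /
`defectWalksDeep_iff_…` BY NAME on `MaxContactCut.DefectWalksDeep`).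
All `--supports stmt-ResolutionOfSingularities-31770`.  Every file of the node is in the Theses cone (the lens
imports the in-cone `DifferentialShade`), so the located
residual is booked on the route by RE-LOCATING the existing aside 28122 `CFNoSkewJointTailsDeep` to
`StallVertex.NoMonomialRegimeSkewStalledTailsDeep` (EXACT,
hypothesis-free chain skew ↔ vertexBound ↔ rigid ↔ lineFree ↔ letterFree ↔ eventFree ↔ straight ↔
monomialRegime: `skew_iff_monomialRegime`) — one aside on this
column, superseding the straight / event-free re-locations (critic row 142f: «file only the newest, exactly one
aside on this column; decided cells not filed»).

THE WIRING of rev 3 / 4 / 5 / 6 VERBATIM, BY NAME on the MaxContactCut aside `DefectWalksDeep` 31770, in lens order: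
`closes_letterFree` / `defectWalksDeep_iff_letterFree`
(§4d), `closes_eventFree` / `defectWalksDeep_iff_eventFree` (§4e), `closes_straight` /
`defectWalksDeep_iff_straight` (§4f), `closes_monomialRegime` /
**`defectWalksDeep_iff_monomialRegime : MaxContactCut.DefectWalksDeep ↔ NoFreePointTailsDeep ∧
CoefficientCut.NoPlanarJointTailsDeep ∧ NoMonomialRegimeSkewStalledTailsDeep`**
(§4g, EXACT).  Imports `StallVertexStraightClasses` and the landed wiring `MaxContactCutStallVertex` (`closes`,
`defectWalksDeep_iff_lineFree`).  Supports 31770.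

[WRITER NOTE (decomp-res writer g8): file split only; namespace, opens, section variables and every declaration
exactly as in the lens (global `set_option` dropped; the lens's `set_option maxHeartbeats … in` lines kept; the
lens's private copy `flat_monomial'` of the landed
`Literature.AlgebraicGeometry.Resolution.PointBlowup.flat_monomial` is dropped and cited by its full name).]

(Sources: KawanoueMatsuki2016 Prop. 4 (2), §4.1; Kawanoue2007 Lemma 2.2.1.2; BierstoneGrigorievMilmanWlodarczyk2011
Def. 3.1.3; Hauser2010; HauserPerlega2024; Moh1987; CossartPiltant2008; Giraud1975; Hironaka1964; ZariskiSamuelII Ch. VIII §2.)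
-/

noncomputable section

open MvPolynomial Finset
open Literature.AlgebraicGeometry.Resolution
open Literature.AlgebraicGeometry.Resolution.Hauser2010
open Literature.AlgebraicGeometry.Resolution.HauserPerlega2024
open Literature.Barriers.ResolutionOfSingularities
open Literature.AlgebraicGeometry.Resolution.PointBlowup
open Summit.ResolutionOfSingularities.ResolutionOfSingularities.Theses
open Summit.ResolutionOfSingularities.ResolutionOfSingularities.Theorems.TightDefectClasses
open Summit.ResolutionOfSingularities.ResolutionOfSingularities.Theorems.ProximityCut
open Summit.ResolutionOfSingularities.ResolutionOfSingularities.Theorems.ExitLaw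
open Summit.ResolutionOfSingularities.ResolutionOfSingularities.Theorems.DifferentialShade

namespace Summit.ResolutionOfSingularities.ResolutionOfSingularities.Theorems.StallVertex

section Classes

/-- `closes` from the letter-free residual, BY NAME. [folklore] -/
theorem closes_letterFree (hA : NoFreePointTailsDeep) (hP : CoefficientCut.NoPlanarJointTailsDeep)
    (hL : NoLetterFreeLineFreeSkewStalledTailsDeep) : MaxContactCut.DefectWalksDeep :=
  closes_lineFree hA hP (lineFree_of_letterFree hL)

/-- EXACT: `DefectWalksDeep ↔ (free-point) ∧ (planar) ∧ (letter-free line-free rigid skew stalled)`. [folklore] -/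
theorem defectWalksDeep_iff_letterFree :
    MaxContactCut.DefectWalksDeep ↔
      NoFreePointTailsDeep ∧ CoefficientCut.NoPlanarJointTailsDeep ∧ NoLetterFreeLineFreeSkewStalledTailsDeep := by
  rw [defectWalksDeep_iff_lineFree, lineFree_iff_letterFree]

/-- `closes` from the event-free residual, BY NAME. [folklore] -/
theorem closes_eventFree (hA : NoFreePointTailsDeep) (hP : CoefficientCut.NoPlanarJointTailsDeep)
    (hE : NoEventFreeLineFreeSkewStalledTailsDeep) : MaxContactCut.DefectWalksDeep :=
  closes_lineFree hA hP (lineFree_of_eventFree hE)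

/-- EXACT: `DefectWalksDeep ↔ (free-point) ∧ (planar) ∧ (event-free line-free rigid skew stalled)`. [folklore] -/
theorem defectWalksDeep_iff_eventFree :
    MaxContactCut.DefectWalksDeep ↔
      NoFreePointTailsDeep ∧ CoefficientCut.NoPlanarJointTailsDeep ∧ NoEventFreeLineFreeSkewStalledTailsDeep := by
  rw [defectWalksDeep_iff_lineFree, lineFree_iff_eventFree]

/-- `closes` from the straight residual, BY NAME. [folklore] -/
theorem closes_straight (hA : NoFreePointTailsDeep) (hP : CoefficientCut.NoPlanarJointTailsDeep)
    (hE : NoStraightEventFreeSkewStalledTailsDeep) : MaxContactCut.DefectWalksDeep :=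
  closes_eventFree hA hP (eventFree_of_straight hE)

/-- EXACT: `DefectWalksDeep ↔ (free-point) ∧ (planar) ∧ (straight event-free line-free rigid skew stalled)`. [folklore] -/
theorem defectWalksDeep_iff_straight :
    MaxContactCut.DefectWalksDeep ↔
      NoFreePointTailsDeep ∧ CoefficientCut.NoPlanarJointTailsDeep ∧ NoStraightEventFreeSkewStalledTailsDeep := by
  rw [defectWalksDeep_iff_eventFree, eventFree_iff_straight]

/-- `closes` from the monomial-regime residual, BY NAME. [folklore] -/
theorem closes_monomialRegime (hA : NoFreePointTailsDeep) (hP : CoefficientCut.NoPlanarJointTailsDeep)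
    (hM : NoMonomialRegimeSkewStalledTailsDeep) : MaxContactCut.DefectWalksDeep :=
  closes_straight hA hP (straight_of_monomialRegime hM)

/-- EXACT: `DefectWalksDeep ↔ (free-point) ∧ (planar) ∧ (interference-or-monomial-regime skew stalled)`. [folklore] -/
theorem defectWalksDeep_iff_monomialRegime :
    MaxContactCut.DefectWalksDeep ↔
      NoFreePointTailsDeep ∧ CoefficientCut.NoPlanarJointTailsDeep ∧ NoMonomialRegimeSkewStalledTailsDeep := by
  rw [defectWalksDeep_iff_straight, straight_iff_monomialRegime]

end Classes

end Summit.ResolutionOfSingularities.ResolutionOfSingularities.Theorems.StallVertex
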